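import Summits.BirchSwinnertonDyer.BirchSwinnertonDyer.Theorems.SignedLowerHalvesKobayashiMainConjectureSmallImageTeichOrbitMuLevel
import HarnessLib

/-!
# Route `SignedLowerHalves`, crux `KobayashiMainConjectureSmallImage` (item stmt-BirchSwinnertonDyer-19002), line `birth_acns` v12,
# stub `stub_muOneSign_ns_ge5`: **prelims for the dictionary from B⁰_ss** — the Manin value of a `T_p`-image word and the
# passage «good elements ⟹ all `p`-power cusps» (cell `bsd-ssimc`, seat `bsd-line-slh-p3` gen 10, LEAD; THEOREMS ONLY; helper)

Three modular-symbol lemmas with no B⁰ in them, split off the consumer `…SmallImageTeichSpanHecke.lean` (≤ 400 lines rule):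
* §A `sum_lifts_eq_sum_fin` — `p` elements of `Γ₀(N)` whose `b`-entries are the `p` lifts of `b mod p^{n+1}` to `ℤ/p^{n+2}` carry the
  first `p` terms of the Hecke relation at `r = v/p^{n+1}`, `v = (b mod p^{n+1})`: `Σ_g [b_g/p^{n+2}]⁺ = Σ_{j<p} [(r+j)/p]⁺`.
* §B `sum_heckePImage_eq` — **the Manin value of a `T_p`-image word** (`heckePImages N p` of `…TeichSpanHeckeDefs`): for any function
  `μ` on `Γ₀(N)` agreeing with `γ ↦ [b(γ)/d(γ)]⁺ − [0]⁺` where `d(γ) ≠ 0` (Manin's homomorphism halved),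
  `Σ_{g ∈ l} μ(g) + μ(δ) = a_p·[v/p^{n+1}]⁺ − (p+1)·[0]⁺` (MTT §I.4 (4.2) `a_p[r]⁺ = Σ_j[(r+j)/p]⁺ + [pr]⁺`).
* §C `norm_sub_lt_one_of_forall_isGoodAt` — if `[b(γ)/d(γ)]⁺ ≡ [0]⁺ (mod p)` for every GOOD `γ ∈ Γ₀(N)` (`|d| = pᵐ`), then
  `[b/pᵏ]⁺ ≡ [0]⁺` for every integer `b` and every `k` (Bezout element `(x b; −yN pᵏ) ∈ Γ₀(N)` for `p ∤ b`; `p ∣ b` lowers the level) —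
  the last step of the f3-mu dictionary (`TeichSpan.exists_teichOrbitSum_sub_of_teichSpanGen`), isolated.
HONEST SCOPE: bookkeeping only; nothing about B⁰ / B⁰_ss / μ is asserted; BSD is not proved by any of this; no summit statement is proved by
this seat.
References: [MazurTateTeitelbaum1986Invent] §I.4 (4.2), §I.10 (10.1); [Manin1972] Prop. 1.4.
-/

-- D-0017: single-problem summit, the namespace repeats the problem name by design.
set_option linter.dupNamespace false
set_option autoImplicit false

noncomputable section

open scoped Classical MatrixGroups ModularForm
open CongruenceSubgroup
open Literature.NumberTheory.EllipticCurves.Rank1Residual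

namespace Summit.BirchSwinnertonDyer.BirchSwinnertonDyer.Theorems.SmallImageTeichSpanHeckePrelims

open Matrix Matrix.SpecialLinearGroup
  Literature.NumberTheory.EllipticCurves Literature.NumberTheory.EllipticCurves.ModularForms
  Summit.BirchSwinnertonDyer.BirchSwinnertonDyer.Theorems.CollapseThree
  Summit.BirchSwinnertonDyer.BirchSwinnertonDyer.Theorems.PrintX8VerticalStevens
  Summit.BirchSwinnertonDyer.BirchSwinnertonDyer.Cruxes.AnalyticMuZeroX9.TeichSpan

/-! ### §A The lifts carried by a `T_p`-image sum to the Hecke fibre -/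

section Lifts

variable {N : ℕ} [NeZero N] {f : CuspForm (Gamma0 N) 2} {p : ℕ} [Fact p.Prime]

/-- **The `p` lifts sum to the Hecke fibre.**  If `l` lists `p` elements of `Γ₀(N)` whose `b`-entries are pairwise distinct mod
`p^{n+2}` and all `≡ b (mod p^{n+1})`, then `Σ_{g ∈ l} [b_g/p^{n+2}]⁺_f = Σ_{j<p} [(v/p^{n+1} + j)/p]⁺_f` with `v = (b mod p^{n+1})`
— the first `p` terms of the Hecke relation `a_p[r]⁺ = Σ_j[(r+j)/p]⁺ + [pr]⁺` at `r = v/p^{n+1}` (the `b`-residues ARE the fibre of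
`b mod p^{n+1}` in `ℤ/p^{n+2}`, and `[x/p^{n+2}]⁺` only depends on `x mod p^{n+2}`).
[cite: MazurTateTeitelbaum1986Invent, §I.4 (4.2)] -/
theorem sum_lifts_eq_sum_fin (n : ℕ) (b : ℤ) {l : List (Gamma0 N)} (hlen : l.length = p)
    (hl : ∀ g ∈ l, ((bEntry g : ℤ) : ZMod (p ^ (n + 1))) = (b : ZMod (p ^ (n + 1))))
    (hnd : (l.map fun g => ((bEntry g : ℤ) : ZMod (p ^ (n + 2)))).Nodup) :
    (l.map fun g ↦ ratPlusSymbol f (((bEntry g : ℤ) : ℚ) / (p : ℚ) ^ (n + 2))).sum =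
      ∑ j : Fin p, ratPlusSymbol f (((((b : ZMod (p ^ (n + 1))).val : ℚ)) / (p : ℚ) ^ (n + 1) + j) / p) := by
  classical
  have hp : p.Prime := Fact.out
  haveI : NeZero (p ^ (n + 1)) := ⟨pow_ne_zero _ hp.ne_zero⟩
  haveI : NeZero (p ^ (n + 2)) := ⟨pow_ne_zero _ hp.ne_zero⟩
  have hpQ : (p : ℚ) ≠ 0 := Nat.cast_ne_zero.mpr hp.ne_zero
  set a : ZMod (p ^ (n + 1)) := (b : ZMod (p ^ (n + 1))) with ha
  -- the list of residues mod `p^{n+2}` and the fibre of `a`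
  set B : List (ZMod (p ^ (n + 2))) := l.map fun g ↦ ((bEntry g : ℤ) : ZMod (p ^ (n + 2))) with hB
  set F : Finset (ZMod (p ^ (n + 2))) := Finset.univ.filter (fun x : ZMod (p ^ (n + 2)) ↦
      ZMod.castHom (pow_dvd_pow p (n + 1).le_succ) (ZMod (p ^ (n + 1))) x = a) with hF
  have hFcard : F.card = p := card_filter_castHom_eq n a
  -- `B.toFinset = F`
  have hBF : B.toFinset = F := by
    apply Finset.eq_of_subset_of_card_le
    · intro x hx
      rw [List.mem_toFinset, hB, List.mem_map] at hx
      obtain ⟨g, hg, rfl⟩ := hx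
      rw [hF, Finset.mem_filter]
      refine ⟨Finset.mem_univ _, ?_⟩
      rw [map_intCast, hl g hg]
    · rw [hFcard, List.toFinset_card_of_nodup hnd, hB, List.length_map, hlen]
  -- rewrite the list sum through the residues
  have h1 : (l.map fun g ↦ ratPlusSymbol f (((bEntry g : ℤ) : ℚ) / (p : ℚ) ^ (n + 2))) =
      B.map fun x ↦ ratPlusSymbol f ((x.val : ℚ) / (p : ℚ) ^ (n + 2)) := by
    rw [hB, List.map_map]
    refine List.map_congr_left fun g _ ↦ ?_
    simp only [Function.comp_apply]
    exact ratPlusSymbol_intCast_div_pow (f := f) (p := p) (n + 2) (bEntry g)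
  rw [h1, ← List.sum_toFinset _ hnd, hBF, hF, filter_castHom_eq_image (n + 1) a, Finset.sum_image]
  · refine Finset.sum_congr rfl fun j _ ↦ ?_
    rw [ratPlusSymbol_natCast_val_div_pow (f := f) (p := p) (n + 2)]
    congr 1
    push_cast
    field_simp
    ring
  · -- injectivity of `j ↦ a.val + p^{n+1} j` into `ℤ/p^{n+2}`
    intro j _ j' _ hjj'
    have hlt : ∀ i : Fin p, a.val + p ^ (n + 1) * (i : ℕ) < p ^ (n + 2) := by
      intro i
      have h1 : a.val < p ^ (n + 1) := ZMod.val_lt _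
      have h2 : (i : ℕ) ≤ p - 1 := Nat.le_sub_one_of_lt i.isLt
      have h3 : p ^ (n + 1) + p ^ (n + 1) * (p - 1) = p ^ (n + 2) := by
        have h4 : p ^ (n + 1) * (p - 1) + p ^ (n + 1) * 1 = p ^ (n + 1) * p := by
          rw [← Nat.mul_add, Nat.sub_add_cancel hp.one_le]
        rw [pow_succ p (n + 1)]; omega
      calc a.val + p ^ (n + 1) * (i : ℕ) < p ^ (n + 1) + p ^ (n + 1) * (p - 1) := by
            have := Nat.mul_le_mul_left (p ^ (n + 1)) h2; omega
        _ = p ^ (n + 2) := h3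
    have h := congr_arg ZMod.val hjj'
    simp only at h
    rw [ZMod.val_natCast_of_lt (hlt j), ZMod.val_natCast_of_lt (hlt j')] at h
    have hp0 : 0 < p ^ (n + 1) := pow_pos hp.pos _
    exact Fin.ext (Nat.eq_of_mul_eq_mul_left hp0 (by omega))

end Lifts

/-! ### §B The Manin value of a `T_p`-image word -/

section HeckeImage

variable {N : ℕ} [NeZero N] {f : CuspForm (Gamma0 N) 2} {p : ℕ} [Fact p.Prime]

/-- **The Manin value of a `T_p`-image word.**  `f` a rational newform on `Γ₀(N)`, `p ∤ N`, `a_p(f) = ap ∈ ℤ`; `l` = `p` elements of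
`Γ₀(N)` with `d = p^{n+2}` and `b`-entries the `p` lifts of `b mod p^{n+1}`; `δ ∈ Γ₀(N)` with `d(δ) = pⁿ`, `b(δ) ≡ b (mod pⁿ)`; `μ` any
function on `Γ₀(N)` with `μ(γ) = [b(γ)/d(γ)]⁺ − [0]⁺` whenever `d(γ) ≠ 0` (half of Manin's homomorphism `γ ↦ re{∞,γ∞}/(Ω⁺/2)`).  Then
`Σ_{g ∈ l} μ(g) + μ(δ) = a_p·[v/p^{n+1}]⁺ − (p+1)·[0]⁺`, `v = (b mod p^{n+1})` — the Hecke relation (4.2) at `r = v/p^{n+1}` read on the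
word `g_0 ⋯ g_{p-1}·δ`. [cite: MazurTateTeitelbaum1986Invent, §I.4 (4.2)] [cite: Manin1972, Prop. 1.4] -/
theorem sum_heckePImage_eq (hf : IsNewform0 f) (hpN : ¬ p ∣ N) {ap : ℤ} (hap : cuspCoeff f p = ap)
    (hrat : ∀ r : ℚ, (ratPlusSymbol f r : ℝ) = normalizedPlusSymbol f r)
    {μ : Gamma0 N → ℚ}
    (hμ : ∀ γ : Gamma0 N, dEntry γ ≠ 0 →
      μ γ = ratPlusSymbol f (((bEntry γ : ℤ) : ℚ) / ((dEntry γ : ℤ) : ℚ)) - ratPlusSymbol f 0)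
    (n : ℕ) (b : ℤ) {l : List (Gamma0 N)} {δ : Gamma0 N} (hlen : l.length = p)
    (hl : ∀ g ∈ l, dEntry g = (p : ℤ) ^ (n + 2) ∧ ((bEntry g : ℤ) : ZMod (p ^ (n + 1))) = (b : ZMod (p ^ (n + 1))))
    (hnd : (l.map fun g => ((bEntry g : ℤ) : ZMod (p ^ (n + 2)))).Nodup)
    (hdδ : dEntry δ = (p : ℤ) ^ n) (hbδ : ((bEntry δ : ℤ) : ZMod (p ^ n)) = (b : ZMod (p ^ n))) :
    (l.map μ).sum + μ δ =
      (ap : ℚ) * ratPlusSymbol f ((((b : ZMod (p ^ (n + 1))).val : ℚ)) / (p : ℚ) ^ (n + 1)) -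
        ((p : ℚ) + 1) * ratPlusSymbol f 0 := by
  classical
  have hp : p.Prime := Fact.out
  haveI : NeZero (p ^ (n + 1)) := ⟨pow_ne_zero _ hp.ne_zero⟩
  set v : ℕ := (b : ZMod (p ^ (n + 1))).val with hv
  have hpQ : (p : ℚ) ≠ 0 := Nat.cast_ne_zero.mpr hp.ne_zero
  -- the Hecke relation at `r = v/p^{n+1}`
  have hH := intCast_mul_ratPlusSymbol p hf hp hpN hap hrat ((v : ℚ) / (p : ℚ) ^ (n + 1))
  -- the lifts
  have hlifts : (l.map fun g ↦ ratPlusSymbol f (((bEntry g : ℤ) : ℚ) / (p : ℚ) ^ (n + 2))).sum =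
      ∑ j : Fin p, ratPlusSymbol f ((((v : ℚ)) / (p : ℚ) ^ (n + 1) + j) / p) :=
    sum_lifts_eq_sum_fin n b hlen (fun g hg ↦ (hl g hg).2) hnd
  -- the drop: `[b_δ/pⁿ]⁺ = [p · v/p^{n+1}]⁺`
  have hdrop : ratPlusSymbol f (((bEntry δ : ℤ) : ℚ) / ((dEntry δ : ℤ) : ℚ)) =
      ratPlusSymbol f ((p : ℚ) * ((v : ℚ) / (p : ℚ) ^ (n + 1))) := by
    have e1 : (p : ℚ) * ((v : ℚ) / (p : ℚ) ^ (n + 1)) = ((v : ℤ) : ℚ) / (p : ℚ) ^ n := by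
      push_cast; rw [pow_succ]; field_simp
    have e2 : ((dEntry δ : ℤ) : ℚ) = (p : ℚ) ^ n := by rw [hdδ]; push_cast; rfl
    have hz : ((bEntry δ : ℤ) : ZMod (p ^ n)) = ((v : ℤ) : ZMod (p ^ n)) := by
      rw [hbδ, hv, Int.cast_natCast, ZMod.natCast_val, ZMod.cast_intCast (pow_dvd_pow p n.le_succ)]
    rw [e2, e1, ratPlusSymbol_intCast_div_pow (f := f) (p := p) n (bEntry δ),
      ratPlusSymbol_intCast_div_pow (f := f) (p := p) n (v : ℤ), hz]
  -- the list: `Σ_g μ(g) = Σ_g [b_g/p^{n+2}]⁺ − p·[0]⁺`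
  have hlist : (l.map μ).sum =
      (l.map fun g ↦ ratPlusSymbol f (((bEntry g : ℤ) : ℚ) / (p : ℚ) ^ (n + 2))).sum - (p : ℚ) * ratPlusSymbol f 0 := by
    have hgen : ∀ l' : List (Gamma0 N), (∀ g ∈ l', dEntry g = (p : ℤ) ^ (n + 2)) →
        (l'.map μ).sum = (l'.map fun g ↦ ratPlusSymbol f (((bEntry g : ℤ) : ℚ) / (p : ℚ) ^ (n + 2))).sum -
          (l'.length : ℚ) * ratPlusSymbol f 0 := by
      intro l' hl'
      induction l' with
      | nil => simp
      | cons g l' ih =>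
        have hd : dEntry g = (p : ℤ) ^ (n + 2) := hl' g (List.mem_cons_self)
        have hd0 : dEntry g ≠ 0 := by rw [hd]; exact pow_ne_zero _ (by exact_mod_cast hp.ne_zero)
        have hg : μ g = ratPlusSymbol f (((bEntry g : ℤ) : ℚ) / (p : ℚ) ^ (n + 2)) - ratPlusSymbol f 0 := by
          rw [hμ g hd0, hd]; push_cast; rfl
        rw [List.map_cons, List.sum_cons, List.map_cons, List.sum_cons, List.length_cons, hg,
          ih (fun g' hg' ↦ hl' g' (List.mem_cons_of_mem g hg'))]
        push_cast; ring
    rw [hgen l (fun g hg ↦ (hl g hg).1), hlen]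
  have hdδ0 : dEntry δ ≠ 0 := by rw [hdδ]; exact pow_ne_zero _ (by exact_mod_cast hp.ne_zero)
  rw [hlist, hμ δ hdδ0, hdrop, hlifts]
  linear_combination -hH

end HeckeImage

/-! ### §C From the good elements to every `p`-power cusp -/

section Good

variable {N : ℕ} [NeZero N] (f : CuspForm (Gamma0 N) 2) {p : ℕ} [Fact p.Prime]

/-- **Good elements control every `p`-power cusp.**  If `[b(γ)/d(γ)]⁺_f ≡ [0]⁺_f (mod p)` for every good `γ ∈ Γ₀(N)` (`|d(γ)| = pᵐ`) and
`p ∤ N`, then `[b/pᵏ]⁺_f ≡ [0]⁺_f` for every integer `b` and every `k`: `p ∣ b` lowers `k`; for `p ∤ b` the Bezout element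
`(x b; −yN pᵏ)` of `Γ₀(N)` is good with cusp `b/pᵏ`.  (The closing step of the f3-mu dictionary, isolated.)
[cite: Manin1972, Prop. 1.4] [cite: MazurTateTeitelbaum1986Invent, §I.10 (10.1)] -/
theorem norm_sub_lt_one_of_forall_isGoodAt (hpN : ¬ p ∣ N)
    (hgood : ∀ γ : Gamma0 N, IsGoodAt p γ →
      ‖((ratPlusSymbol f (((bEntry γ : ℤ) : ℚ) / ((dEntry γ : ℤ) : ℚ)) - ratPlusSymbol f 0 : ℚ) : ℚ_[p])‖ < 1)
    (k : ℕ) (b : ℤ) :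
    ‖((ratPlusSymbol f ((b : ℚ) / (p : ℚ) ^ k) - ratPlusSymbol f 0 : ℚ) : ℚ_[p])‖ < 1 := by
  have hp : p.Prime := Fact.out
  have hpZ : Prime (p : ℤ) := Nat.prime_iff_prime_int.mp hp
  have hpNZ : ¬ (p : ℤ) ∣ (N : ℤ) := fun h ↦ hpN (by exact_mod_cast h)
  induction k generalizing b with
  | zero =>
    rw [pow_zero, div_one, show (b : ℚ) = 0 + ((b : ℤ) : ℚ) by simp, ratPlusSymbol_add_intCast_eq, sub_self,
      Rat.cast_zero, norm_zero]
    exact zero_lt_one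
  | succ k ih =>
    by_cases hpb : (p : ℤ) ∣ b
    · obtain ⟨b', rfl⟩ := hpb
      have hpQ : (p : ℚ) ≠ 0 := Nat.cast_ne_zero.mpr hp.ne_zero
      have e : (((p : ℤ) * b' : ℤ) : ℚ) / (p : ℚ) ^ (k + 1) = (b' : ℚ) / (p : ℚ) ^ k := by
        push_cast; rw [pow_succ]; field_simp
      rw [e]; exact ih b'
    · have hcop : IsCoprime ((p : ℤ) ^ (k + 1)) (b * N) :=
        IsCoprime.pow_left (IsCoprime.mul_right ((Prime.coprime_iff_not_dvd hpZ).mpr hpb)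
          ((Prime.coprime_iff_not_dvd hpZ).mpr hpNZ))
      obtain ⟨x, y, hxy⟩ := hcop
      have hdet : Matrix.det !![x, b; -(y * N), (p : ℤ) ^ (k + 1)] = 1 := by
        rw [Matrix.det_fin_two_of]; linear_combination hxy
      have hw0 : (((-(y * (N : ℤ)) : ℤ)) : ZMod N) = 0 := by push_cast; rw [ZMod.natCast_self]; ring
      have hmemN : (⟨!![x, b; -(y * N), (p : ℤ) ^ (k + 1)], hdet⟩ : SL(2, ℤ)) ∈ Gamma0 N :=
        Gamma0_mem.mpr (by simp [hw0])
      set γ₁ : Gamma0 N := ⟨⟨!![x, b; -(y * N), (p : ℤ) ^ (k + 1)], hdet⟩, hmemN⟩ with hγ₁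
      have hb : bEntry γ₁ = b := rfl
      have hd : dEntry γ₁ = (p : ℤ) ^ (k + 1) := rfl
      have hγgood : IsGoodAt p γ₁ := ⟨k + 1, by rw [hd, Int.natAbs_pow, Int.natAbs_natCast]⟩
      have h := hgood γ₁ hγgood
      rw [hb, hd] at h
      push_cast at h
      exact h

end Good

end Summit.BirchSwinnertonDyer.BirchSwinnertonDyer.Theorems.SmallImageTeichSpanHeckePrelims

end
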